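import Literature.Probability.RandomPlanarGeometry.SLE
import Literature.Probability.RandomPlanarGeometry.RestrictionHullsHolds
import Literature.Probability.RandomPlanarGeometry.CritPercSLESimplePathHolds
import Literature.Probability.RandomPlanarGeometry.CritPercSLESimplePathProofs
import Literature.Probability.RandomPlanarGeometry.CritPercSLELocalityMartingaleProofs
import Literature.Probability.RandomPlanarGeometry.SLETransienceKappaEightHolds
import Literature.Probability.RandomPlanarGeometry.LoewnerCurveLimitDomain
import Literature.Probability.RandomPlanarGeometry.LoewnerTransformContinuity
import Literature.Probability.RandomPlanarGeometry.LoewnerMapProofs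
import Literature.Probability.RandomPlanarGeometry.SLERestrictionLemmas
import Literature.Probability.RandomPlanarGeometry.SLEBoundaryHittingProofs
import HarnessLib

/-!
# `stub_sleHullPackage` — the SLE_{8/3} side of the line `bidir_windows` (crux `PathUpgradeR`,
stmt-CriticalPhenomena-18055, route `SAWReversalUpgrade`)

Landing target:
`Summits/CriticalPhenomena/SAWScalingLimit/Theorems/SAWReversalUpgradePathUpgradeRSLEHullPackage.lean`
(`--supports stmt-CriticalPhenomena-18055`; registered stub `stub_sleHullPackage` of
`Cruxes/PathUpgradeR/Lines/bidir_windows.lean`, statement verbatim).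

**Theorem.** Assume `HullHausdorff` (Hausdorff stability of closed Loewner hulls at simple-curve
chains under uniform convergence of the drivers on `[0, T]`; the statement of the neighbour stub
`stub_hullHausdorff`, taken here as a hypothesis). Then for every Dobrushin domain `D` with chordal
uniformizing map `φ` (boundary extension `φ̄`):

1. for every `T > 0` and Wiener-a.e. `ω`, with `W = √(8/3) B(ω)` and `γ` the SLE_{8/3} trace,
   `closure K_T(W) = γ[0, T]`, and the map `W' ↦ φ̄ (closure K_T(W'))` is continuous at `W` for the
   sup-norm on `[0, T]` and the Hausdorff distance;
2. for Wiener-a.e. `ω`, `φ̄ (γ t) → D.pt 1` as `t → ∞`.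

**Proof.** (1) A.e. the chain is generated by its trace (Rohde–Schramm Thm. 5.1 at `κ = 8/3`,
`hasSLETrace_eightThirds`), the trace is simple (`κ = 8/3 ≤ 4`, Rohde–Schramm Thm. 6.1,
`ae_isSimpleTrace_sleTrace_of_le_four_holds`) and no real point `x ≠ 0` is swallowed
(`sle_swallowingTime_ofReal_eq_top_holds` for `x > 0`; a fixed `x < 0` by the point-independence
of `P{T_x < ∞}`, `measure_sle_swallowingTime_lt_top_eq`; all `x < 0` at once by reflection
`swallowingTime_neg_ofReal` and monotonicity, `Loewner.forall_swallowingTime_eq_top_of_seq`).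
Then `K_T = γ(0, T]` (`hull_eq_image`), whose closure is `γ[0, T]`. Continuity by contradiction:
drivers `W_n` with `sup_{[0,T]} |W_n - W| ≤ 1/(n+1)` converge uniformly, so `HullHausdorff` gives
`closure K_T(W_n) → γ[0,T]` in Hausdorff distance; all these sets lie in a fixed compact
`B̄(0, R) ∩ {0 ≤ im}` (`hull_subset_closedBall_driving`) on which `φ̄` is uniformly continuous
(`continuousOn_boundaryExtension_im_nonneg`), and uniformly continuous maps are Hausdorff-continuous
on subsets of a compact. (2) Transience (Rohde–Schramm Thm. 7.1, `κ = 8/3 ≠ 8`,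
`tendsto_norm_sleTrace_atTop_of_ne_eight`) composed with `φ̄ z → D.pt 1` as `z → ∞` in
`{0 ≤ im}` (`MarkedDomain.IsChordalUniformizing.tendsto_boundaryExtension_cocompact`). [folklore]
-/

noncomputable section

open Set Filter Metric Topology MeasureTheory
open scoped NNReal
open UpperHalfPlane (upperHalfPlaneSet)

namespace Summit.CriticalPhenomena.SAWScalingLimit.Theorems

namespace PathUpgradeRSLEHullPackage

open Literature.Probability Literature.Probability.RandomPlanarGeometry
open Literature.Probability.RandomPlanarGeometry.Loewner

/-! ### Almost surely no real point other than `0` is swallowed (`κ ≤ 4`) -/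

/-- For `κ ≤ 4` and a fixed real `x ≠ 0`, almost surely `T_x = ⊤`: `P{T_x < ∞} = P{T_1 < ∞}`
(`measure_sle_swallowingTime_lt_top_eq`) and `P{T_1 < ∞} = 0`
(`sle_swallowingTime_ofReal_eq_top_holds`). [folklore] -/
theorem ae_swallowingTime_eq_top {κ : ℝ≥0} (hκ : κ ≤ 4) {x : ℝ} (hx : x ≠ 0) :
    ∀ᵐ ω ∂Process.preWienerMeasure, swallowingTime (sleDriving κ ω) x = ⊤ := by
  have hpos : ∀ᵐ ω ∂Process.preWienerMeasure, ∀ y : ℝ, 0 < y →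
      swallowingTime (sleDriving κ ω) y = ⊤ := sle_swallowingTime_ofReal_eq_top_holds hκ
  have h1 : Process.preWienerMeasure
      {ω | swallowingTime (sleDriving κ ω) ((1 : ℝ) : ℂ) < ⊤} = 0 := by
    rw [measure_eq_zero_iff_ae_notMem]
    filter_upwards [hpos] with ω hω
    intro (h : swallowingTime (sleDriving κ ω) ((1 : ℝ) : ℂ) < ⊤)
    rw [hω 1 one_pos] at h
    exact lt_irrefl _ h
  have h2 : Process.preWienerMeasure {ω | swallowingTime (sleDriving κ ω) x < ⊤} = 0 := by
    rw [measure_sle_swallowingTime_lt_top_eq κ hx one_ne_zero]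
    exact h1
  rw [measure_eq_zero_iff_ae_notMem] at h2
  filter_upwards [h2] with ω hω
  exact not_lt_top_iff.1 hω

/-- For `κ ≤ 4`, almost surely no real point `x ≠ 0` is swallowed: `T_x = ⊤` for all `x ≠ 0`
simultaneously (positive points: `sle_swallowingTime_ofReal_eq_top_holds`; negative points: the
countably many null events `{T_{-1/(n+1)} < ∞}`, reflection `swallowingTime_neg_ofReal` and
monotonicity `Loewner.forall_swallowingTime_eq_top_of_seq`). [folklore] -/
theorem ae_forall_swallowingTime_eq_top {κ : ℝ≥0} (hκ : κ ≤ 4) :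
    ∀ᵐ ω ∂Process.preWienerMeasure,
      ∀ x : ℝ, x ≠ 0 → swallowingTime (sleDriving κ ω) x = ⊤ := by
  have hpos : ∀ᵐ ω ∂Process.preWienerMeasure, ∀ y : ℝ, 0 < y →
      swallowingTime (sleDriving κ ω) y = ⊤ := sle_swallowingTime_ofReal_eq_top_holds hκ
  have hneg : ∀ᵐ ω ∂Process.preWienerMeasure, ∀ n : ℕ,
      swallowingTime (sleDriving κ ω) ((-(1 / ((n : ℝ) + 1)) : ℝ) : ℂ) = ⊤ :=
    ae_all_iff.2 fun n ↦ ae_swallowingTime_eq_top hκ (neg_ne_zero.2 (by positivity))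
  filter_upwards [hpos, hneg] with ω hωp hωn x hx
  rcases hx.lt_or_gt with h | h
  · have key := forall_swallowingTime_eq_top_of_seq (W := fun s ↦ -sleDriving κ ω s)
      (continuous_sleDriving κ ω).neg (by simp) (fun n ↦ ?_) (neg_pos.2 h)
    · rwa [swallowingTime_neg_ofReal] at key
    · have h' := swallowingTime_neg_ofReal (sleDriving κ ω) (-(1 / ((n : ℝ) + 1)))
      rw [neg_neg] at h'
      rw [h']
      exact hωn n
  · exact hωp x h

/-! ### The closed hull of a simple-curve chain -/

/-- For a chain with continuous driving function generated by a simple curve `γ` and `T > 0`,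
`closure K_T = γ[0, T]` (`K_T = γ(0, T]`, `hull_eq_image`; `γ[0, T] ⊆ closure K_T`,
`image_Icc_subset_closure_hull`). [folklore] -/
theorem closure_hull_eq_image {V : ℝ≥0 → ℝ} {γ : ℝ≥0 → ℂ} (hV : Continuous V)
    (hgen : IsGeneratedByCurve V γ) (hs : IsSimpleTrace γ) {T : ℝ≥0} (hT : 0 < T) :
    closure (hull V T) = γ '' Icc 0 T := by
  refine Subset.antisymm ?_ (hgen.image_Icc_subset_closure_hull hV hT)
  refine closure_minimal ?_ ((isCompact_Icc.image hgen.continuous).isClosed)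
  rw [hgen.hull_eq_image hs T]
  exact image_mono Ioc_subset_Icc_self

/-! ### Hausdorff continuity of uniformly continuous maps -/

/-- If `f` has modulus `(δ, ε)` on `K` and `A, B ⊆ K` are nonempty bounded sets at Hausdorff
distance `< δ`, then `f '' A`, `f '' B` are at Hausdorff distance `≤ ε`. [folklore] -/
theorem hausdorffDist_image_le {f : ℂ → ℂ} {K A B : Set ℂ} {ε δ : ℝ} (hε : 0 ≤ ε)
    (hf : ∀ x ∈ K, ∀ y ∈ K, dist x y ≤ δ → dist (f x) (f y) ≤ ε) (hA : A ⊆ K)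
    (hB : B ⊆ K)
    (hAne : A.Nonempty) (hBne : B.Nonempty) (hAb : Bornology.IsBounded A)
    (hBb : Bornology.IsBounded B) (h : hausdorffDist A B < δ) :
    hausdorffDist (f '' A) (f '' B) ≤ ε := by
  have hfin : hausdorffEDist A B ≠ ⊤ :=
    hausdorffEDist_ne_top_of_nonempty_of_bounded hAne hBne hAb hBb
  refine hausdorffDist_le_of_mem_dist hε ?_ ?_
  · rintro _ ⟨a, ha, rfl⟩
    obtain ⟨b, hb, hab⟩ := exists_dist_lt_of_hausdorffDist_lt ha h hfin
    exact ⟨f b, mem_image_of_mem f hb, hf a (hA ha) b (hB hb) hab.le⟩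
  · rintro _ ⟨b, hb, rfl⟩
    obtain ⟨a, ha, hab⟩ := exists_dist_lt_of_hausdorffDist_lt' hb h hfin
    exact ⟨f a, mem_image_of_mem f ha, hf b (hB hb) a (hA ha) (by rw [dist_comm]; exact hab.le)⟩

/-! ### An a-priori compact containing all closed hulls of nearby drivers -/

/-- If `‖V s‖ ≤ C` on `[0, T]` and `|W' s - V s| ≤ 1` on `[0, T]` for a continuous `W'`, then
`closure K_T(W') ⊆ B̄(0, R) ∩ {0 ≤ im}` with `R = (C + 1) + ((2C + 2) + 4√T)`
(`hull_subset_closedBall_driving`). [folklore] -/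
theorem closure_hull_subset_of_close {V W' : ℝ≥0 → ℝ} {T : ℝ≥0} {C : ℝ}
    (hC : ∀ s ∈ Icc (0 : ℝ≥0) T, ‖V s‖ ≤ C) (hW' : Continuous W')
    (hclose : ∀ s : ℝ≥0, s ≤ T → |W' s - V s| ≤ 1) :
    closure (hull W' T) ⊆
      closedBall (0 : ℂ) ((C + 1) + ((2 * C + 2) + 4 * Real.sqrt T)) ∩ {z : ℂ | 0 ≤ z.im} := by
  refine closure_minimal ?_
    ((isClosed_closedBall).inter (isClosed_le continuous_const Complex.continuous_im))
  intro z hz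
  have hW0 : |W' 0| ≤ C + 1 := by
    have hd := hclose 0 zero_le
    have hV0 : |V 0| ≤ C := by simpa [Real.norm_eq_abs] using hC 0 (left_mem_Icc.2 zero_le)
    have := abs_sub_abs_le_abs_sub (W' 0) (V 0)
    linarith
  have hS : ∀ s : ℝ≥0, s ≤ T → |W' s - W' 0| ≤ 2 * C + 2 := by
    intro s hs'
    have hd := hclose s hs'
    have hVs : |V s| ≤ C := by simpa [Real.norm_eq_abs] using hC s ⟨zero_le, hs'⟩
    have h3 := abs_sub_abs_le_abs_sub (W' s) (V s)
    have hWs : |W' s| ≤ C + 1 := by linarith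
    calc |W' s - W' 0| ≤ |W' s| + |W' 0| := abs_sub _ _
      _ ≤ (C + 1) + (C + 1) := add_le_add hWs hW0
      _ = 2 * C + 2 := by ring
  have hball := hull_subset_closedBall_driving hW' hS hz
  have hzim : 0 < z.im := hull_subset W' T hz
  refine ⟨?_, hzim.le⟩
  rw [mem_closedBall, dist_zero_right]
  rw [mem_closedBall, dist_eq_norm] at hball
  have hnorm0 : ‖((W' 0 : ℝ) : ℂ)‖ ≤ C + 1 := by
    rw [Complex.norm_real, Real.norm_eq_abs]; exact hW0
  calc ‖z‖ = ‖(z - (W' 0 : ℂ)) + (W' 0 : ℂ)‖ := by rw [sub_add_cancel]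
    _ ≤ ‖z - (W' 0 : ℂ)‖ + ‖((W' 0 : ℝ) : ℂ)‖ := norm_add_le _ _
    _ ≤ ((2 * C + 2) + 4 * Real.sqrt T) + (C + 1) := add_le_add hball hnorm0
    _ = (C + 1) + ((2 * C + 2) + 4 * Real.sqrt T) := by ring

/-! ### Continuity of `W' ↦ f (closure K_T(W'))` at a simple-curve chain -/

/-- **Deterministic core of the continuity clause.** If the closed hulls of drivers converging
uniformly to `V` on `[0, T]` converge in Hausdorff distance to `γ[0, T] = closure K_T(V)` (the
instance of `HullHausdorff` at the chain of `V`) and `f` is continuous on `{0 ≤ im}`, then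
`W' ↦ f '' closure K_T(W')` is continuous at `V` for the sup-norm on `[0, T]` and the Hausdorff
distance. By contradiction, with the a-priori compact of
`closure_hull_subset_of_close` and the uniform continuity of `f` on it. [folklore] -/
theorem exists_forall_hausdorffDist_image_le {V : ℝ≥0 → ℝ} {γ : ℝ≥0 → ℂ} {T : ℝ≥0} {f : ℂ → ℂ}
    (H : ∀ W : ℕ → ℝ≥0 → ℝ, (∀ n, Continuous (W n)) → TendstoUniformlyOn W V atTop (Icc 0 T) →
      Tendsto (fun n => hausdorffDist (closure (hull (W n) T)) (γ '' Icc 0 T)) atTop (𝓝 0))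
    (hV : Continuous V) (hclos : closure (hull V T) = γ '' Icc 0 T)
    (hf : ContinuousOn f {z : ℂ | 0 ≤ z.im}) {ε : ℝ} (hε : 0 < ε) :
    ∃ ρ : ℝ, 0 < ρ ∧ ∀ W' : ℝ≥0 → ℝ, Continuous W' →
      (∀ s : ℝ≥0, s ≤ T → |W' s - V s| ≤ ρ) →
      hausdorffDist (f '' closure (hull W' T)) (f '' closure (hull V T)) ≤ ε := by
  by_contra hcon
  push Not at hcon
  choose W hWc hWclose hWfar using fun n : ℕ ↦ hcon (1 / ((n : ℝ) + 1)) (by positivity)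
  -- the drivers `W n` converge uniformly to `V` on `[0, T]`
  have hconv : TendstoUniformlyOn W V atTop (Icc 0 T) := by
    rw [Metric.tendstoUniformlyOn_iff]
    intro δ hδ
    obtain ⟨N, hN⟩ := exists_nat_one_div_lt hδ
    filter_upwards [eventually_ge_atTop N] with n hn s hs
    rw [Real.dist_eq, abs_sub_comm]
    have hNn : (1 : ℝ) / ((n : ℝ) + 1) ≤ 1 / ((N : ℝ) + 1) := by
      gcongr
    exact ((hWclose n s hs.2).trans hNn).trans_lt hN
  have hlim := H W hWc hconv
  -- the a-priori compact and the uniform continuity of `f` on it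
  obtain ⟨C, hC⟩ := (isCompact_Icc : IsCompact (Icc (0 : ℝ≥0) T)).exists_bound_of_continuousOn
    hV.continuousOn
  set K : Set ℂ := closedBall (0 : ℂ) ((C + 1) + ((2 * C + 2) + 4 * Real.sqrt T)) ∩
    {z : ℂ | 0 ≤ z.im} with hK
  have hKc : IsCompact K :=
    (isCompact_closedBall _ _).inter_right (isClosed_le continuous_const Complex.continuous_im)
  have hsubK : ∀ W' : ℝ≥0 → ℝ, Continuous W' →
      (∀ s : ℝ≥0, s ≤ T → |W' s - V s| ≤ 1) → closure (hull W' T) ⊆ K :=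
    fun W' hW' hcl ↦ closure_hull_subset_of_close hC hW' hcl
  have hVK : γ '' Icc 0 T ⊆ K := by
    rw [← hclos]
    exact hsubK V hV fun s _ ↦ by simp
  obtain ⟨δ, hδ, hfδ⟩ := Metric.uniformContinuousOn_iff_le.1
    (hKc.uniformContinuousOn_of_continuous (hf.mono inter_subset_right)) ε hε
  -- an index with Hausdorff-close closed hull
  obtain ⟨n, hn⟩ := (hlim.eventually (gt_mem_nhds hδ)).exists
  have hfar := hWfar n
  rw [hclos] at hfar
  rcases (closure (hull (W n) T)).eq_empty_or_nonempty with hemp | hne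
  · rw [hemp, image_empty, hausdorffDist_empty'] at hfar
    exact absurd hfar (not_lt.2 hε.le)
  · have h1 : (1 : ℝ) / ((n : ℝ) + 1) ≤ 1 := by
      rw [div_le_one (by positivity)]
      linarith [(n.cast_nonneg : (0 : ℝ) ≤ n)]
    have hWK : closure (hull (W n) T) ⊆ K :=
      hsubK (W n) (hWc n) fun s hs ↦ (hWclose n s hs).trans h1
    have hle : hausdorffDist (f '' closure (hull (W n) T)) (f '' (γ '' Icc 0 T)) ≤ ε :=
      hausdorffDist_image_le hε.le hfδ hWK hVK hne ⟨γ 0, ⟨0, left_mem_Icc.2 zero_le, rfl⟩⟩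
        (hKc.isBounded.subset hWK) (hKc.isBounded.subset hVK) hn
    exact absurd hfar (not_lt.2 hle)

/-! ### The tip tends to `b` -/

/-- If `‖γ t‖ → ∞`, `0 ≤ im γ`, and `f z → b` as `z → ∞` within `{0 ≤ im}`, then for every
`ε > 0` there is `T₀` with `dist (f (γ t)) b ≤ ε` for `t ≥ T₀`. [folklore] -/
theorem exists_forall_dist_comp_le {γ : ℝ≥0 → ℂ} {f : ℂ → ℂ} {b : ℂ}
    (hγ : Tendsto (fun t ↦ ‖γ t‖) atTop atTop) (him : ∀ t, 0 ≤ (γ t).im)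
    (hf : Tendsto f (cocompact ℂ ⊓ 𝓟 {z : ℂ | 0 ≤ z.im}) (𝓝 b)) {ε : ℝ}
    (hε : 0 < ε) : ∃ T₀ : ℝ≥0, ∀ t : ℝ≥0, T₀ ≤ t → dist (f (γ t)) b ≤ ε := by
  have h1 : Tendsto γ atTop (cocompact ℂ) :=
    tendsto_cocompact_of_tendsto_dist_comp_atTop (0 : ℂ) (by simpa [dist_zero_right] using hγ)
  have h2 : Tendsto γ atTop (𝓟 {z : ℂ | 0 ≤ z.im}) :=
    tendsto_principal.2 (Eventually.of_forall him)
  have h3 : Tendsto (fun t ↦ f (γ t)) atTop (𝓝 b) := hf.comp (tendsto_inf.2 ⟨h1, h2⟩)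
  obtain ⟨T₀, hT₀⟩ := Metric.tendsto_atTop.1 h3 ε hε
  exact ⟨T₀, fun t ht ↦ (hT₀ t ht).le⟩

end PathUpgradeRSLEHullPackage

open PathUpgradeRSLEHullPackage Literature.Probability Literature.Probability.RandomPlanarGeometry
  Literature.Probability.RandomPlanarGeometry.Loewner in
/-- **The SLE_{8/3} hull package of the line `bidir_windows`** (registered stub
`stub_sleHullPackage`, statement verbatim): under `HullHausdorff`, for every Dobrushin domain with a
chordal uniformizing map, (1) for `T > 0` and Wiener-a.e. `ω`, `closure K_T(√(8/3)B) = γ[0, T]` and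
`W' ↦ φ̄ (closure K_T(W'))` is continuous at `√(8/3) B(ω)` (sup-norm on `[0, T]`, Hausdorff
distance), and (2) a.e. `φ̄ (γ t) → D.pt 1`. Rohde–Schramm (2005) Thms. 5.1, 6.1, 7.1 and the
deterministic Loewner/Carathéodory facts of the tree. [folklore] -/
theorem stub_sleHullPackage : (∀ (W : ℕ → NNReal → ℝ) (V : NNReal → ℝ) (γ : NNReal → ℂ) (T : NNReal), 0 < T → (∀ n, Continuous (W n)) → Continuous V → Literature.Probability.RandomPlanarGeometry.Loewner.IsGeneratedByCurve V γ → Literature.Probability.RandomPlanarGeometry.Loewner.IsSimpleTrace γ → (∀ x : ℝ, x ≠ V 0 → (T : WithTop NNReal) < Literature.Probability.RandomPlanarGeometry.Loewner.swallowingTime V (x : ℂ)) → TendstoUniformlyOn W V Filter.atTop (Set.Icc 0 T) → Filter.Tendsto (fun n => Metric.hausdorffDist (closure (Literature.Probability.RandomPlanarGeometry.Loewner.hull (W n) T)) (γ '' Set.Icc 0 T)) Filter.atTop (nhds 0)) → ∀ (D : Literature.Probability.RandomPlanarGeometry.DobrushinDomain) (φ : Literature.Probability.RandomPlanarGeometry.ConformalEquiv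 UpperHalfPlane.upperHalfPlaneSet D.carrier), D.IsChordalUniformizing φ → (∀ T : NNReal, 0 < T → ∀ᵐ ω ∂Literature.Probability.Process.preWienerMeasure, closure (Literature.Probability.RandomPlanarGeometry.Loewner.hull (Literature.Probability.RandomPlanarGeometry.sleDriving ((8:NNReal)/3) ω) T) = Literature.Probability.RandomPlanarGeometry.sleTrace ((8:NNReal)/3) ω '' Set.Icc 0 T ∧ ∀ ε : ℝ, 0 < ε → ∃ ρ : ℝ, 0 < ρ ∧ ∀ W' : NNReal → ℝ, Continuous W' → (∀ s : NNReal, s ≤ T → |W' s - Literature.Probability.RandomPlanarGeometry.sleDriving ((8:NNReal)/3) ω s| ≤ ρ) → Metric.hausdorffDist (φ.boundaryExtension '' closure (Literature.Probability.RandomPlanarGeometry.Loewner.hull W' T)) (φ.boundaryExtension '' closure (Literature.Probability.RandomPlanarGeometry.Loewner.hull (Literature.Probability.RandomPlanarGeometry.sleDriving ((8:NNReal)/3) ω) T)) ≤ ε) ∧ (∀ᵐ ω ∂Literature.Probability.Process.preWienerMeasure, ∀ ε : ℝ, 0 < ε → ∃ T₀ : NNReal, ∀ t : NNReal, T₀ ≤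 t → dist (φ.boundaryExtension (Literature.Probability.RandomPlanarGeometry.sleTrace ((8:NNReal)/3) ω t)) (D.pt 1) ≤ ε) := by
  intro H D φ hφ
  have hκ0 : (0 : ℝ≥0) < 8 / 3 := by positivity
  have hκ4 : (8 : ℝ≥0) / 3 ≤ 4 := by
    rw [div_le_iff₀ (by norm_num : (0 : ℝ≥0) < 3)]
    norm_num
  have hgen := ae_isGeneratedByCurve_sleTrace hasSLETrace_eightThirds
  refine ⟨fun T hT ↦ ?_, ?_⟩
  · filter_upwards [hgen, ae_isSimpleTrace_sleTrace_of_le_four_apply hκ0 hκ4,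
      ae_forall_swallowingTime_eq_top hκ4] with ω hωg hωs hωT
    have hV := continuous_sleDriving ((8 : ℝ≥0) / 3) ω
    have hreal : ∀ x : ℝ, x ≠ sleDriving ((8 : ℝ≥0) / 3) ω 0 →
        (T : WithTop ℝ≥0) < swallowingTime (sleDriving ((8 : ℝ≥0) / 3) ω) (x : ℂ) := by
      intro x hx
      rw [sleDriving_zero] at hx
      rw [hωT x hx]
      exact WithTop.coe_lt_top T
    have hclos := closure_hull_eq_image hV hωg hωs hT
    refine ⟨hclos, fun ε hε ↦ ?_⟩
    exact exists_forall_hausdorffDist_image_le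
      (fun W hW hconv ↦ H W _ _ T hT hW hV hωg hωs hreal hconv) hV hclos
      (continuousOn_boundaryExtension_im_nonneg φ) hε
  · filter_upwards [tendsto_norm_sleTrace_atTop_of_ne_eight hκ0 eightThirds_ne_eight, hgen]
      with ω hωt hωg ε hε
    exact exists_forall_dist_comp_le hωt hωg.im_nonneg hφ.tendsto_boundaryExtension_cocompact hε

end Summit.CriticalPhenomena.SAWScalingLimit.Theorems

end
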